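import Literature.AlgebraicGeometry.Frobenioids.GeometricFrobenioids
import HarnessLib

/-!
# Frobenioids I, Example 6.1: `Prime(Φ(L)) ≃ D_L` for the monoid of Cartier effective divisors — PROOF

Mochizuki, *The geometry of Frobenioids I: the general theory*, Kyushu J. Math. **62** (2008) 293–400,
Example 6.1, kurims text p. 109: "moreover, one verifies immediately that `Φ(L)` is perf-factorial, that there
is a natural bijection `Prime(Φ(L)) → D_L`, and that the supports of elements of `Φ(L)` are precisely the
finite subsets of `D_L`"; primes = `≼`-classes of primary elements (§0 p. 12). [cite: MochizukiFrdI2008, Ex. 6.1 p.109]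

PROVED here (seat abc-iut-L6-t10) — abc-iut-L1-t3's named statement `Ex61_primes Γ` (`GeometricFrobenioids.lean`
v3), for EVERY instance `Γ : GeometricDivisorData K Kt` of the interface (only the field `qCartier` — every
prime divisor has a Cartier multiple `k_P · P ∈ Φ(L)` — is used; `Φ(L) ⊆ ℤ_{≥0}[D_L]` is an arbitrary submonoid
otherwise, so `≼` is computed INSIDE `Φ(L)`):
* `support_subset_of_precsim` — `D ≼ E` forces `supp D ⊆ supp E`;
* `prod_smul_mem` — a coefficient vector supported in `T` becomes an element of `Φ(L)` after multiplication
  by `∏_{t ∈ T} k_t`;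
* `support_eq_singleton_of_isPrimary` — a primary element of `Φ(L)` is supported at ONE prime divisor
  (`N · D_s · s ≼ D` for `N = ∏_{supp D} k_t`, since `N · (D − D_s · s) ∈ Φ(L)`);
* `single_precsim_single` — two elements of `Φ(L)` supported at the same prime divisor are `≼`-comparable
  (`(i + 1) · (j · s) = i · s + ((j − 1) · (i · s) + j · s)`);
* `isPrimary_of_support_eq_singleton` — conversely, single support implies primary;
* `Ex61_primes_holds : Ex61_primes Γ` — `P ↦ [k_P · P]` is a bijection `D_L → Prime(Φ(L))` taking the class
  of every Cartier multiple `n · P`.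
No definitions; nothing here bears on [IUTchIII] or asserts anything about abc.
-/

noncomputable section

namespace Literature.AlgebraicGeometry.Frobenioids

open CategoryTheory Function

namespace GeometricDivisorData

variable {K : Type} [Field K] {Kt : Type} [Field Kt] [Algebra K Kt] (Γ : GeometricDivisorData K Kt)
  (X : FinSubextCat K Kt)

/-- Divisibility in `Φ(L)` (written multiplicatively): `D ∣ E` iff `E = D + C` for some `C ∈ Φ(L)` — the
complement must itself be a Cartier effective divisor. [cite: MochizukiFrdI2008, Ex. 6.1 p.109] -/
theorem ofAdd_dvd_ofAdd_iff {D E : Γ.Phi X} :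
    Multiplicative.ofAdd D ∣ Multiplicative.ofAdd E ↔
      ∃ C : Γ.Phi X, (E : Γ.primeDiv X →₀ ℕ) = (D : Γ.primeDiv X →₀ ℕ) + (C : Γ.primeDiv X →₀ ℕ) := by
  constructor
  · rintro ⟨x, hx⟩
    refine ⟨Multiplicative.toAdd x, ?_⟩
    have h := congrArg Multiplicative.toAdd hx
    rw [toAdd_ofAdd, toAdd_mul, toAdd_ofAdd] at h
    exact congrArg Subtype.val h
  · rintro ⟨C, hC⟩
    refine ⟨Multiplicative.ofAdd C, ?_⟩
    rw [← ofAdd_add]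
    exact congrArg Multiplicative.ofAdd (Subtype.ext hC)

/-- **`D ≼ E` forces `supp D ⊆ supp E`** (`D + C = n · E` coefficientwise). [cite: MochizukiFrdI2008, Ex. 6.1 p.109] -/
theorem support_subset_of_precsim {D E : Γ.Phi X}
    (h : Precsim (Multiplicative.ofAdd D) (Multiplicative.ofAdd E)) :
    (D : Γ.primeDiv X →₀ ℕ).support ⊆ (E : Γ.primeDiv X →₀ ℕ).support := by
  obtain ⟨n, -, hdvd⟩ := h
  rw [← ofAdd_nsmul, ofAdd_dvd_ofAdd_iff] at hdvd
  obtain ⟨C, hC⟩ := hdvd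
  intro P hP
  rw [Finsupp.mem_support_iff] at hP ⊢
  intro hE
  have := DFunLike.congr_fun hC P
  simp only [AddSubmonoidClass.coe_nsmul, Finsupp.coe_smul, Pi.smul_apply, smul_eq_mul, hE, mul_zero,
    Finsupp.coe_add, Pi.add_apply] at this
  omega

/-- A coefficient vector supported in a finite set `T` becomes a Cartier effective divisor after
multiplication by `∏_{t ∈ T} k_t`, where `k_t · t ∈ Φ(L)` (`qCartier`). [cite: MochizukiFrdI2008, Ex. 6.1 p.109] -/
theorem prod_smul_mem (T : Finset (Γ.primeDiv X)) (k : Γ.primeDiv X → ℕ)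
    (hk : ∀ P, Finsupp.single P (k P) ∈ Γ.Phi X) (v : Γ.primeDiv X →₀ ℕ) (hv : v.support ⊆ T) :
    (∏ t ∈ T, k t) • v ∈ Γ.Phi X := by
  classical
  have hv' : (∏ t ∈ T, k t) • v = ∑ t ∈ v.support, (∏ t ∈ T, k t) • Finsupp.single t (v t) := by
    conv_lhs => rw [← Finsupp.sum_single v]
    rw [Finsupp.sum, Finset.smul_sum]
  rw [hv']
  refine sum_mem fun t ht => ?_
  rw [Finsupp.smul_single, smul_eq_mul, ← Finset.prod_erase_mul T k (hv ht),
    show (∏ x ∈ T.erase t, k x) * k t * v t = ((∏ x ∈ T.erase t, k x) * v t) • k t by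
      rw [smul_eq_mul]; ring,
    ← Finsupp.smul_single]
  exact AddSubmonoid.nsmul_mem _ (hk t) _

/-- **A primary element of `Φ(L)` is supported at a single prime divisor**: if `s ∈ supp D` and
`N = ∏_{t ∈ supp D} k_t`, then `N · D_s · s ∈ Φ(L)` divides `N · D` inside `Φ(L)`, so `N · D_s · s ≼ D`, and
primality gives `D ≼ N · D_s · s`, whence `supp D ⊆ {s}`. [cite: MochizukiFrdI2008, Ex. 6.1 p.109] -/
theorem support_eq_singleton_of_isPrimary {D : Γ.Phi X} (hD : IsPrimary (Multiplicative.ofAdd D)) :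
    ∃ s, (D : Γ.primeDiv X →₀ ℕ).support = {s} := by
  classical
  choose k hk0 hk using Γ.qCartier X
  have hD0 : (D : Γ.primeDiv X →₀ ℕ) ≠ 0 := fun h =>
    hD.1 (by rw [show D = 0 from Subtype.ext h]; rfl)
  obtain ⟨s, hs⟩ := Finsupp.support_nonempty_iff.mpr hD0
  set T := (D : Γ.primeDiv X →₀ ℕ).support with hT
  set N := ∏ t ∈ T, k t with hN
  have hN0 : 0 < N := Finset.prod_pos fun t _ => hk0 t
  have hDs : 0 < (D : Γ.primeDiv X →₀ ℕ) s := Nat.pos_of_ne_zero (Finsupp.mem_support_iff.mp hs)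
  -- the element `b = N · D_s · s` of `Φ(L)`
  have hbmem : Finsupp.single s (N * (D : Γ.primeDiv X →₀ ℕ) s) ∈ Γ.Phi X := by
    rw [hN, ← Finset.prod_erase_mul T k hs,
      show (∏ x ∈ T.erase s, k x) * k s * (D : Γ.primeDiv X →₀ ℕ) s =
        ((∏ x ∈ T.erase s, k x) * (D : Γ.primeDiv X →₀ ℕ) s) • k s by rw [smul_eq_mul]; ring,
      ← Finsupp.smul_single]
    exact AddSubmonoid.nsmul_mem _ (hk s) _
  have hb1 : Multiplicative.ofAdd (⟨_, hbmem⟩ : Γ.Phi X) ≠ 1 := by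
    intro h
    have := DFunLike.congr_fun (congrArg Subtype.val (Multiplicative.ofAdd.injective h)) s
    rw [Finsupp.single_eq_same] at this
    exact (Nat.mul_pos hN0 hDs).ne' this
  -- `b ≼ D`: `N · D = b + N · (D − D_s · s)`
  have hble : Precsim (Multiplicative.ofAdd (⟨_, hbmem⟩ : Γ.Phi X)) (Multiplicative.ofAdd D) := by
    refine ⟨N, hN0, ?_⟩
    rw [← ofAdd_nsmul, ofAdd_dvd_ofAdd_iff]
    have hcmem : N • Finsupp.erase s (D : Γ.primeDiv X →₀ ℕ) ∈ Γ.Phi X :=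
      Γ.prod_smul_mem X T k hk _ (by rw [Finsupp.support_erase]; exact Finset.erase_subset _ _)
    refine ⟨⟨_, hcmem⟩, ?_⟩
    change N • (D : Γ.primeDiv X →₀ ℕ) = Finsupp.single s (N * (D : Γ.primeDiv X →₀ ℕ) s) +
      N • Finsupp.erase s (D : Γ.primeDiv X →₀ ℕ)
    conv_lhs => rw [← Finsupp.single_add_erase s (D : Γ.primeDiv X →₀ ℕ)]
    rw [smul_add, Finsupp.smul_single, smul_eq_mul]
  have hDb := hD.2 _ hb1 hble
  have hsub := Γ.support_subset_of_precsim X hDb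
  refine ⟨s, Finset.eq_singleton_iff_unique_mem.mpr ⟨hs, fun t ht => ?_⟩⟩
  have := hsub ht
  rw [Finsupp.support_single _ (Nat.mul_pos hN0 hDs).ne', Finset.mem_singleton] at this
  exact this

/-- **Two elements of `Φ(L)` supported at the same prime divisor are `≼`-comparable**: for `i · s, j · s ∈ Φ(L)`
with `j ≥ 1`, `(i + 1) · (j · s) = i · s + ((j − 1) · (i · s) + j · s)` exhibits `i · s ∣ (j · s)^{i+1}` inside
`Φ(L)`. [cite: MochizukiFrdI2008, Ex. 6.1 p.109] -/
theorem single_precsim_single {s : Γ.primeDiv X} {i j : ℕ} (hi : Finsupp.single s i ∈ Γ.Phi X)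
    (hj : Finsupp.single s j ∈ Γ.Phi X) (hj0 : 0 < j) :
    Precsim (Multiplicative.ofAdd (⟨_, hi⟩ : Γ.Phi X)) (Multiplicative.ofAdd (⟨_, hj⟩ : Γ.Phi X)) := by
  refine ⟨i + 1, Nat.succ_pos i, ?_⟩
  rw [← ofAdd_nsmul, ofAdd_dvd_ofAdd_iff]
  refine ⟨⟨(j - 1) • Finsupp.single s i + Finsupp.single s j,
    add_mem (AddSubmonoid.nsmul_mem _ hi _) hj⟩, ?_⟩
  change (i + 1) • Finsupp.single s j = Finsupp.single s i + ((j - 1) • Finsupp.single s i + Finsupp.single s j)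
  obtain ⟨j', rfl⟩ := Nat.exists_eq_add_one_of_ne_zero hj0.ne'
  simp only [Finsupp.smul_single, smul_eq_mul, ← Finsupp.single_add, Nat.add_sub_cancel]
  congr 1
  ring

/-- **An element of `Φ(L)` supported at a single prime divisor is primary.** [cite: MochizukiFrdI2008, Ex. 6.1 p.109] -/
theorem isPrimary_of_support_eq_singleton {D : Γ.Phi X} {s : Γ.primeDiv X}
    (hs : (D : Γ.primeDiv X →₀ ℕ).support = {s}) : IsPrimary (Multiplicative.ofAdd D) := by
  have hDs : (D : Γ.primeDiv X →₀ ℕ) s ≠ 0 := Finsupp.mem_support_iff.mp (by rw [hs]; exact Finset.mem_singleton_self s)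
  have hD : (D : Γ.primeDiv X →₀ ℕ) = Finsupp.single s ((D : Γ.primeDiv X →₀ ℕ) s) :=
    Finsupp.support_subset_singleton.mp (by rw [hs])
  refine ⟨fun h => ?_, fun b hb hle => ?_⟩
  · have := congrArg Subtype.val (Multiplicative.ofAdd.injective h)
    rw [this] at hs
    exact (Finset.singleton_ne_empty s) (hs.symm.trans Finsupp.support_zero)
  · set E : Γ.Phi X := Multiplicative.toAdd b with hE
    have hb' : b = Multiplicative.ofAdd E := (ofAdd_toAdd b).symm
    rw [hb'] at hle ⊢
    have hsub := Γ.support_subset_of_precsim X hle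
    rw [hs] at hsub
    have hE' : (E : Γ.primeDiv X →₀ ℕ) = Finsupp.single s ((E : Γ.primeDiv X →₀ ℕ) s) :=
      Finsupp.support_subset_singleton.mp hsub
    have hEs : 0 < (E : Γ.primeDiv X →₀ ℕ) s := by
      refine Nat.pos_of_ne_zero fun h0 => hb ?_
      rw [hb']
      have : (E : Γ.primeDiv X →₀ ℕ) = 0 := by rw [hE', h0, Finsupp.single_zero]
      rw [show E = 0 from Subtype.ext this]
      rfl
    have hmemD : Finsupp.single s ((D : Γ.primeDiv X →₀ ℕ) s) ∈ Γ.Phi X := hD ▸ D.2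
    have hmemE : Finsupp.single s ((E : Γ.primeDiv X →₀ ℕ) s) ∈ Γ.Phi X := hE' ▸ E.2
    rw [show D = ⟨_, hmemD⟩ from Subtype.ext hD, show E = ⟨_, hmemE⟩ from Subtype.ext hE']
    exact Γ.single_precsim_single X hmemD hmemE hEs

/-- **Example 6.1: "there is a natural bijection `Prime(Φ(L)) → D_L`"** (FrdI p. 109) — abc-iut-L1-t3's named
statement `Ex61_primes Γ` PROVED for every instance of the interface `GeometricDivisorData`: `P ↦` the class
of a Cartier multiple `k_P · P` is a well-defined bijection `D_L → Prime(Φ(L))` (independent of the multiple,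
and taking the class of every `n · P ∈ Φ(L)`, `n ≥ 1`). [cite: MochizukiFrdI2008, Ex. 6.1 p.109] -/
theorem Ex61_primes_holds : Ex61_primes Γ := by
  intro X
  classical
  choose k hk0 hk using Γ.qCartier X
  have hsupp : ∀ (P : Γ.primeDiv X) {n : ℕ}, 0 < n → (Finsupp.single P n).support = {P} := fun P n hn =>
    Finsupp.support_single _ hn.ne'
  have hprim : ∀ P, IsPrimary (Multiplicative.ofAdd (⟨Finsupp.single P (k P), hk P⟩ : Γ.Phi X)) := fun P =>
    Γ.isPrimary_of_support_eq_singleton X (hsupp P (hk0 P))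
  refine ⟨fun P => Quotient.mk (primarySetoid _) ⟨_, hprim P⟩, ⟨fun P Q h => ?_, fun 𝔭 => ?_⟩,
    fun P n hn hn0 => ?_⟩
  · have h' : Precsim (Multiplicative.ofAdd (⟨Finsupp.single P (k P), hk P⟩ : Γ.Phi X))
        (Multiplicative.ofAdd (⟨Finsupp.single Q (k Q), hk Q⟩ : Γ.Phi X)) := Quotient.exact h
    have hsub := Γ.support_subset_of_precsim X h'
    change (Finsupp.single P (k P)).support ⊆ (Finsupp.single Q (k Q)).support at hsub
    rw [hsupp P (hk0 P), hsupp Q (hk0 Q), Finset.singleton_subset_iff, Finset.mem_singleton] at hsub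
    exact hsub
  · induction 𝔭 using Quotient.ind with
    | _ a =>
      obtain ⟨a, ha⟩ := a
      have ha' : IsPrimary (Multiplicative.ofAdd (Multiplicative.toAdd a)) := ha
      obtain ⟨s, hs⟩ := Γ.support_eq_singleton_of_isPrimary X ha'
      refine ⟨s, Quotient.sound ?_⟩
      change Precsim (Multiplicative.ofAdd (⟨Finsupp.single s (k s), hk s⟩ : Γ.Phi X)) a
      set E : Γ.Phi X := Multiplicative.toAdd a
      have hE : (E : Γ.primeDiv X →₀ ℕ) = Finsupp.single s ((E : Γ.primeDiv X →₀ ℕ) s) :=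
        Finsupp.support_subset_singleton.mp (by rw [hs])
      have hEs : 0 < (E : Γ.primeDiv X →₀ ℕ) s :=
        Nat.pos_of_ne_zero (Finsupp.mem_support_iff.mp (by rw [hs]; exact Finset.mem_singleton_self s))
      have hmemE : Finsupp.single s ((E : Γ.primeDiv X →₀ ℕ) s) ∈ Γ.Phi X := hE ▸ E.2
      rw [← ofAdd_toAdd a, show Multiplicative.toAdd a = (⟨_, hmemE⟩ : Γ.Phi X) from Subtype.ext hE]
      exact Γ.single_precsim_single X (hk s) hmemE hEs
  · exact ⟨Γ.isPrimary_of_support_eq_singleton X (hsupp P hn0),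
      Quotient.sound (Γ.single_precsim_single X (hk P) hn hn0)⟩

end GeometricDivisorData

end Literature.AlgebraicGeometry.Frobenioids

end
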